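import Mathlib.LinearAlgebra.Matrix.ToLinearEquiv
import Mathlib.LinearAlgebra.Matrix.Adjugate
import Mathlib.LinearAlgebra.Matrix.Charpoly.Coeff
import Mathlib.LinearAlgebra.Matrix.StdBasis
import Mathlib.LinearAlgebra.Basis.Prod
import Mathlib.LinearAlgebra.FiniteDimensional.Lemmas
import Mathlib.LinearAlgebra.Dimension.Finite
import Literature.Computability.AlgebraicComplexity.DegenerationSpectralMonotone
import HarnessLib

/-!
# The commutant obstruction: a large slice-pencil commutant forbids degeneration to a rigid pencil

Route `FarEdgeDescent` (decomposition cell `decomp-mm`, lens 2 «structural dichotomy», gen 29),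
support for the aside `SubLogRate` (stmt-MatrixMultiplication-25371) through its named idea
«Q-𝔖 / transpose cashing» (`Theorems/FarEdgeDescentTwistedStarCore.lean`): the abstract half of
the CONVERSE rigidity theorem `⟨n,n,2L⟩^{⊠N} ⋭ 𝔖_n(L)^{⊠N}`
(`Theorems/FarEdgeDescentConverseRigidity.lean`).

For a tensor `s : ι → κ → μ → K` write `S_b = s(·,b,·)` (an `ι × μ` matrix) for its slices along
the middle slot.  The **commutant of the slice pencil** is
`D(s) = {(β, γ) ∈ K^{ι×ι} × K^{μ×μ} : β S_b = S_b γ for all b}` (the endomorphisms of the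
Kronecker module of the pencil).  Its dimension is an orbit-closure invariant that is NOT visibly
monotone in the coordinate calculus of `AlgDegeneratesTo` (BCS (15.19): the border matrices
`A(ε), B(ε), C(ε)` need not be invertible).  We prove monotonicity in two elementary steps:
* **Generic invertibility** (`IsApproxRestriction.perturb`): in `t ⊴_h s` (same first and third
  index types) one may replace `A(ε)`, `C(ε)` by `A + ε^M 1`, `C + ε^M 1` (`M > h` large): the
  coefficients up to order `h` do not change and `det(A + ε^M 1) = χ_{-A}(ε^M) ≠ 0` (top
  coefficient `1` in degree `M·#ι` once `M` exceeds the degrees of the coefficients of `χ_{-A}`).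
* **The obstruction** (`not_algDegeneratesTo_of_commutant`): if `D(s)` contains a family
  `(β_r, γ_r)_{r ∈ R₀}` with `(β_r)` linearly independent and `D(t)` lies in a subspace of
  dimension `< #R₀`, then `¬ (t ⊴ s)`: conjugation by the border matrices and their adjugates
  moves the family into the commutant of the polynomial pencil `S^ε_{b'} = A (∑_b B_{b'b} S_b) Cᵀ`
  (entries of order `h`, leading tensor `t`); these `#R₀` vectors are `K[ε]`-independent and stay
  independent together with constant lifts of a basis of the image of
  `Φ_t : (β,γ) ↦ (β T_{b'} - T_{b'} γ)_{b'}` (trailing coefficients), so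
  `#R₀ ≤ dim ker Φ_t ≤ dim D(t)` by counting ranks of free `K[ε]`-modules.
All statements are over an arbitrary field `K`; no `sorry`, no new definitions besides `slice`.

## References

* P. Bürgisser, M. Clausen, M. A. Shokrollahi, *Algebraic Complexity Theory*, Springer (1997),
  (15.19)–(15.25) (degeneration of order `h`). [BurgisserClausenShokrollahi1997]
* V. Strassen, *The asymptotic spectrum of tensors*, J. reine angew. Math. 384 (1988), §3.
  [Strassen1988]
-/

noncomputable section

open scoped BigOperators Polynomial
set_option linter.dupNamespace false

namespace Summit.MatrixMultiplication.MatrixMultiplication.Theorems.FarEdgeDescentCommutantObstruction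

open Literature.Computability.AlgebraicComplexity Polynomial

variable {K : Type*} [Field K]
variable {ι κ μ κ' : Type*}

/-! ## Step 1: generic invertibility of the border matrices -/

/-- A monic polynomial over `K[X]`, evaluated at `X ^ M` with `M` larger than the degrees of its
lower coefficients, is non-zero: the coefficient of `X^{M·deg}` is `1`. [folklore] -/
theorem eval_X_pow_ne_zero_of_monic (p : K[X][X]) (hp : p.Monic) {M : ℕ}
    (hM : ∀ i < p.natDegree, (p.coeff i).natDegree < M) : p.eval ((X : K[X]) ^ M) ≠ 0 := by
  intro h0
  have hc : (p.eval ((X : K[X]) ^ M)).coeff (M * p.natDegree) = 1 := by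
    rw [eval_eq_sum_range, finsetSum_coeff, Finset.sum_range_succ, hp.coeff_natDegree, one_mul,
      ← pow_mul, coeff_X_pow_self, Finset.sum_eq_zero, zero_add]
    intro i hi
    rw [Finset.mem_range] at hi
    obtain ⟨d, hd⟩ : ∃ d, p.natDegree = i + (d + 1) := ⟨p.natDegree - i - 1, by omega⟩
    rw [← pow_mul, coeff_mul_X_pow', if_pos (Nat.mul_le_mul_left M hi.le)]
    apply coeff_eq_zero_of_natDegree_lt
    have e : M * p.natDegree - M * i = M * d + M := by
      have e1 : M * p.natDegree = M * i + (M * d + M) := by rw [hd]; ring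
      rw [e1, Nat.add_sub_cancel_left]
    rw [e]
    exact lt_of_lt_of_le (hM i hi) (Nat.le_add_left _ _)
  rw [h0, coeff_zero] at hc
  exact zero_ne_one hc

/-- **Generic invertibility of a diagonal perturbation**: for a square polynomial matrix `A`,
`det (A + ε^M · 1) = χ_{-A}(ε^M) ≠ 0` for all large `M`. [folklore] -/
theorem exists_det_add_X_pow_ne_zero [Fintype ι] [DecidableEq ι] (A : Matrix ι ι K[X]) :
    ∃ M₀ : ℕ, ∀ M, M₀ ≤ M → (A + ((X : K[X]) ^ M) • (1 : Matrix ι ι K[X])).det ≠ 0 := by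
  set p : K[X][X] := (-A).charpoly with hp
  refine ⟨(∑ i ∈ Finset.range p.natDegree, (p.coeff i).natDegree) + 1, fun M hM => ?_⟩
  have hmat : A + ((X : K[X]) ^ M) • (1 : Matrix ι ι K[X]) =
      Matrix.scalar ι ((X : K[X]) ^ M) - (-A) := by
    ext i j
    simp only [Matrix.add_apply, Matrix.smul_apply, Matrix.one_apply, Matrix.sub_apply,
      Matrix.neg_apply, Matrix.scalar_apply, Matrix.diagonal_apply, smul_eq_mul]
    split_ifs <;> ring
  rw [hmat, ← Matrix.eval_charpoly]
  apply eval_X_pow_ne_zero_of_monic p (Matrix.charpoly_monic _)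
  intro i hi
  have h1 : (p.coeff i).natDegree ≤ ∑ j ∈ Finset.range p.natDegree, (p.coeff j).natDegree :=
    Finset.single_le_sum (f := fun j => (p.coeff j).natDegree) (fun _ _ => Nat.zero_le _)
      (Finset.mem_range.2 hi)
  omega

/-- The perturbed border matrix in matrix form. [folklore] -/
theorem of_add_X_pow_mul_ite {ν : Type*} [DecidableEq ν] (A : ν → ν → K[X]) (M : ℕ) :
    (Matrix.of fun a' a => A a' a + X ^ M * (if a' = a then 1 else 0)) =
      Matrix.of A + ((X : K[X]) ^ M) • (1 : Matrix ν ν K[X]) := by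
  ext i j
  simp only [Matrix.of_apply, Matrix.add_apply, Matrix.smul_apply, Matrix.one_apply, smul_eq_mul]

/-- **Generic invertibility in a degeneration** (`t ⊴_h s` with equal first and third index
types): the border matrices `A(ε)`, `C(ε)` may be taken with non-zero determinant — replace them by
`A + ε^M 1`, `C + ε^M 1` with `M > h` large; the coefficients up to order `h` do not change.
[cite: BurgisserClausenShokrollahi1997, (15.19)] -/
theorem IsApproxRestriction.perturb [Fintype ι] [Fintype κ] [Fintype μ] [DecidableEq ι]
    [DecidableEq μ] {h : ℕ} {s : ι → κ → μ → K} {t : ι → κ' → μ → K} {A : ι → ι → K[X]}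
    {B : κ' → κ → K[X]} {C : μ → μ → K[X]} (hd : IsApproxRestriction h s t A B C) :
    ∃ (A' : ι → ι → K[X]) (C' : μ → μ → K[X]), (Matrix.of A').det ≠ 0 ∧ (Matrix.of C').det ≠ 0 ∧
      IsApproxRestriction h s t A' B C' := by
  obtain ⟨M₁, hM₁⟩ := exists_det_add_X_pow_ne_zero (Matrix.of A)
  obtain ⟨M₃, hM₃⟩ := exists_det_add_X_pow_ne_zero (Matrix.of C)
  set M : ℕ := M₁ + M₃ + h + 1 with hMdef
  refine ⟨fun a' a => A a' a + X ^ M * (if a' = a then 1 else 0),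
    fun c' c => C c' c + X ^ M * (if c' = c then 1 else 0), ?_, ?_, ?_⟩
  · rw [of_add_X_pow_mul_ite]
    exact hM₁ M (by omega)
  · rw [of_add_X_pow_mul_ite]
    exact hM₃ M (by omega)
  · intro a' b' c' j hj
    have hsum : (∑ a, ∑ b, ∑ c, (A a' a + X ^ M * (if a' = a then 1 else 0)) * B b' b *
        (C c' c + X ^ M * (if c' = c then 1 else 0)) * Polynomial.C (s a b c)) =
        (∑ a, ∑ b, ∑ c, A a' a * B b' b * C c' c * Polynomial.C (s a b c)) +
        X ^ M * ∑ a, ∑ b, ∑ c, ((if a' = a then 1 else 0) * B b' b *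
          (C c' c + X ^ M * (if c' = c then 1 else 0)) +
          A a' a * B b' b * (if c' = c then 1 else 0)) * Polynomial.C (s a b c) := by
      rw [Finset.mul_sum, ← Finset.sum_add_distrib]
      refine Finset.sum_congr rfl fun a _ => ?_
      rw [Finset.mul_sum, ← Finset.sum_add_distrib]
      refine Finset.sum_congr rfl fun b _ => ?_
      rw [Finset.mul_sum, ← Finset.sum_add_distrib]
      refine Finset.sum_congr rfl fun c _ => ?_
      ring
    rw [hsum, coeff_add, hd a' b' c' j hj, coeff_X_pow_mul', if_neg (show ¬ M ≤ j by omega), add_zero]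

/-! ## Step 2: trailing coefficients -/

/-- The coefficient of `ε^{d+h}` in `g · q` when `q` has order `h` with leading value `t₀` and `g`
has order at least `d`. [folklore] -/
theorem coeff_mul_of_order (g q : K[X]) (d h : ℕ) (t₀ : K)
    (hq : ∀ j ≤ h, q.coeff j = if j = h then t₀ else 0) (hg : ∀ i < d, g.coeff i = 0) :
    (g * q).coeff (d + h) = g.coeff d * t₀ := by
  rw [coeff_mul, Finset.sum_eq_single (d, h)]
  · rw [hq h le_rfl, if_pos rfl]
  · intro x hx hne
    rw [Finset.mem_antidiagonal] at hx
    rcases lt_trichotomy x.1 d with hlt | heq | hgt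
    · rw [hg x.1 hlt, zero_mul]
    · exfalso
      exact hne (Prod.ext heq (show x.2 = h by omega))
    · have h2 : x.2 < h := by omega
      rw [hq x.2 h2.le, if_neg h2.ne, mul_zero]
  · intro hnot
    simp [Finset.mem_antidiagonal] at hnot

/-- A scalar multiple of a polynomial matrix by a non-zero polynomial vanishes only if the matrix
does (`K[ε]` is a domain). [folklore] -/
theorem matrix_eq_zero_of_smul_eq_zero {m n : Type*} {c : K[X]} {M : Matrix m n K[X]} (hc : c ≠ 0)
    (h : c • M = 0) : M = 0 := by
  refine Matrix.ext fun i j => ?_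
  have h1 := congr_fun (congr_fun h i) j
  simp only [Matrix.smul_apply, smul_eq_mul, Matrix.zero_apply] at h1
  exact (mul_eq_zero.1 h1).resolve_left hc

/-! ## Step 3: the obstruction -/

/-- The slice `s(·, b, ·)` of a tensor along its middle slot, as an `ι × μ` matrix. -/
def slice {L : Type*} (s : ι → κ → μ → L) (b : κ) : Matrix ι μ L := Matrix.of fun a c => s a b c

/-- Entries of a slice. [folklore] -/
@[simp] theorem slice_apply {L : Type*} (s : ι → κ → μ → L) (b : κ) (a : ι) (c : μ) :
    slice s b a c = s a b c := rfl

/-- **The commutant obstruction.**  Let the slice pencil of `s` commute with a family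
`(β_r, γ_r)_{r ∈ R₀}` (`β_r S_b = S_b γ_r` for all middle indices `b`) whose first components are
linearly independent, and let every pair `(β', γ')` commuting with the slice pencil of `t` lie in a
subspace `D` with `dim D < #R₀`.  If `s` and `t` have the same first and third index types, then
`t` is NOT a degeneration of `s` (BCS (15.19)): `¬ (t ⊴ s)`.  Invariant behind it: the dimension
of the commutant of the slice pencil (endomorphisms of the Kronecker module), which can only grow
under degeneration. [cite: BurgisserClausenShokrollahi1997, (15.19)] -/
theorem not_algDegeneratesTo_of_commutant [Fintype ι] [Fintype κ] [Fintype μ] [Fintype κ']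
    [DecidableEq ι] [DecidableEq μ] {R₀ : Type*} [Fintype R₀]
    (s : ι → κ → μ → K) (t : ι → κ' → μ → K) (β : R₀ → Matrix ι ι K) (γ : R₀ → Matrix μ μ K)
    (hcomm : ∀ r b, β r * slice s b = slice s b * γ r) (hβ : LinearIndependent K β)
    (D : Submodule K (Matrix ι ι K × Matrix μ μ K))
    (hD : ∀ (β' : Matrix ι ι K) (γ' : Matrix μ μ K),
      (∀ b', β' * slice t b' = slice t b' * γ') → (β', γ') ∈ D)
    (hlt : Module.finrank K D < Fintype.card R₀) : ¬ AlgDegeneratesTo s t := by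
  classical
  rintro ⟨h, A₀, B, C₀, hd₀⟩
  obtain ⟨A, C, hA, hC, hd⟩ := IsApproxRestriction.perturb hd₀
  set Am : Matrix ι ι K[X] := Matrix.of A with hAm
  set Cm : Matrix μ μ K[X] := Matrix.of C with hCm
  set S : κ' → Matrix ι μ K[X] := fun b' => Matrix.of fun a' c' =>
    ∑ a, ∑ b, ∑ c, A a' a * B b' b * C c' c * Polynomial.C (s a b c) with hS
  have hScoeff : ∀ b' a' c' j, j ≤ h → (S b' a' c').coeff j = if j = h then t a' b' c' else 0 :=
    fun b' a' c' => hd a' b' c'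
  set N : κ' → Matrix ι μ K[X] := fun b' => ∑ b, B b' b • (slice s b).map Polynomial.C with hN
  have hSfac : ∀ b', S b' = Am * N b' * Cm.transpose := by
    intro b'
    refine Matrix.ext fun a' c' => ?_
    simp only [hS, hN, hAm, hCm, Matrix.of_apply, Matrix.mul_apply, Matrix.transpose_apply,
      Matrix.sum_apply, Matrix.smul_apply, Matrix.map_apply, slice_apply, smul_eq_mul]
    calc ∑ a, ∑ b, ∑ c, A a' a * B b' b * C c' c * Polynomial.C (s a b c)
        = ∑ c, ∑ a, ∑ b, A a' a * B b' b * C c' c * Polynomial.C (s a b c) := by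
          rw [Finset.sum_congr rfl fun a _ => Finset.sum_comm, Finset.sum_comm]
      _ = ∑ c, (∑ a, A a' a * ∑ b, B b' b * Polynomial.C (s a b c)) * C c' c := by
          refine Finset.sum_congr rfl fun c _ => ?_
          rw [Finset.sum_mul]
          refine Finset.sum_congr rfl fun a _ => ?_
          rw [Finset.mul_sum, Finset.sum_mul]
          refine Finset.sum_congr rfl fun b _ => ?_
          ring
  have hcommN : ∀ r b', (β r).map Polynomial.C * N b' = N b' * (γ r).map Polynomial.C := by
    intro r b'
    simp only [hN, Matrix.mul_sum, Matrix.sum_mul, Matrix.mul_smul, Matrix.smul_mul]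
    refine Finset.sum_congr rfl fun b _ => ?_
    rw [← Matrix.map_mul, hcomm r b, Matrix.map_mul]
  -- the conjugated family inside the commutant of the polynomial pencil
  set βt : R₀ → Matrix ι ι K[X] := fun r =>
    Cm.det • (Am * (β r).map Polynomial.C * Am.adjugate) with hβt
  set γt : R₀ → Matrix μ μ K[X] := fun r =>
    Am.det • (Cm.transpose.adjugate * (γ r).map Polynomial.C * Cm.transpose) with hγt
  have h1 : Am.adjugate * Am = Am.det • (1 : Matrix ι ι K[X]) := Matrix.adjugate_mul Am
  have h2 : Cm.transpose * Cm.transpose.adjugate = Cm.det • (1 : Matrix μ μ K[X]) := by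
    rw [Matrix.mul_adjugate, Matrix.det_transpose]
  have hcommX : ∀ r b', βt r * S b' = S b' * γt r := by
    intro r b'
    rw [hSfac]
    calc Cm.det • (Am * (β r).map Polynomial.C * Am.adjugate) * (Am * N b' * Cm.transpose)
        = Cm.det • (Am * (β r).map Polynomial.C * (Am.adjugate * Am) * N b' * Cm.transpose) := by
          simp only [Matrix.smul_mul, Matrix.mul_assoc]
      _ = (Cm.det * Am.det) • (Am * ((β r).map Polynomial.C * N b') * Cm.transpose) := by
          rw [h1, Matrix.mul_smul, Matrix.mul_one, Matrix.smul_mul, Matrix.smul_mul, smul_smul,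
            Matrix.mul_assoc Am]
      _ = (Am.det * Cm.det) • (Am * N b' * ((γ r).map Polynomial.C * Cm.transpose)) := by
          rw [hcommN, mul_comm, ← Matrix.mul_assoc Am, Matrix.mul_assoc]
      _ = Am.det • (Am * N b' * (Cm.transpose * Cm.transpose.adjugate) *
            ((γ r).map Polynomial.C * Cm.transpose)) := by
          rw [h2, Matrix.mul_smul, Matrix.mul_one, Matrix.smul_mul, smul_smul]
      _ = Am * N b' * Cm.transpose *
            (Am.det • (Cm.transpose.adjugate * (γ r).map Polynomial.C * Cm.transpose)) := by
          simp only [Matrix.mul_smul, Matrix.mul_assoc]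
  -- `K[ε]`-independence of the conjugated family (from `K`-independence of `β`)
  have hind : ∀ f : R₀ → K[X], ∑ r, f r • βt r = 0 → ∀ r, f r = 0 := by
    intro f hf
    set Nβ : Matrix ι ι K[X] := ∑ r, f r • (β r).map Polynomial.C with hNβ
    have hsum : ∑ r, f r • βt r = Cm.det • (Am * Nβ * Am.adjugate) := by
      have e : ∀ r, f r • βt r = Cm.det • (Am * (f r • (β r).map Polynomial.C) * Am.adjugate) := by
        intro r
        rw [hβt, Matrix.mul_smul, Matrix.smul_mul, smul_smul, smul_smul, mul_comm]
      simp only [e, hNβ, ← Finset.smul_sum, Matrix.mul_sum, Matrix.sum_mul]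
    rw [hsum] at hf
    have h3 := matrix_eq_zero_of_smul_eq_zero hC hf
    have h4 : Am.adjugate * (Am * Nβ * Am.adjugate) * Am = (Am.det * Am.det) • Nβ := by
      calc Am.adjugate * (Am * Nβ * Am.adjugate) * Am
          = (Am.adjugate * Am) * Nβ * (Am.adjugate * Am) := by simp only [Matrix.mul_assoc]
        _ = (Am.det * Am.det) • Nβ := by
          rw [h1, Matrix.smul_mul, Matrix.one_mul, Matrix.mul_smul, Matrix.mul_one, smul_smul]
    rw [h3, Matrix.mul_zero, Matrix.zero_mul] at h4
    have h5 : Nβ = 0 := matrix_eq_zero_of_smul_eq_zero (mul_ne_zero hA hA) h4.symm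
    have h6 : ∀ e : ℕ, ∑ r, ((f r).coeff e) • β r = 0 := by
      intro e
      refine Matrix.ext fun i j => ?_
      have h7 := congr_fun (congr_fun h5 i) j
      simp only [hNβ, Matrix.sum_apply, Matrix.smul_apply, Matrix.map_apply, smul_eq_mul,
        Matrix.zero_apply] at h7
      have h8 := congr_arg (fun q : K[X] => q.coeff e) h7
      simp only [finsetSum_coeff, coeff_mul_C, coeff_zero] at h8
      simpa [Matrix.sum_apply] using h8
    intro r
    ext e
    rw [coeff_zero]
    exact Fintype.linearIndependent_iff.1 hβ (fun r => (f r).coeff e) (h6 e) r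
  -- the commutator map of the target pencil and a basis of its image with constant lifts
  set Φ : (Matrix ι ι K × Matrix μ μ K) →ₗ[K] (κ' → Matrix ι μ K) :=
    { toFun := fun p b' => p.1 * slice t b' - slice t b' * p.2
      map_add' := fun p q => by
        funext b'
        simp only [Prod.fst_add, Prod.snd_add, Pi.add_apply, Matrix.add_mul, Matrix.mul_add]
        abel
      map_smul' := fun c p => by
        funext b'
        simp only [Prod.smul_fst, Prod.smul_snd, Pi.smul_apply, RingHom.id_apply,
          Matrix.smul_mul, Matrix.mul_smul, smul_sub] } with hΦ
  have hker : LinearMap.ker Φ ≤ D := fun p hp =>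
    hD p.1 p.2 fun b' => sub_eq_zero.1 (congr_fun (LinearMap.mem_ker.1 hp) b')
  set ρ : ℕ := Module.finrank K (LinearMap.range Φ) with hρ
  set bR := Module.finBasis K (LinearMap.range Φ) with hbR
  have hu : ∀ i : Fin ρ, ∃ u : Matrix ι ι K × Matrix μ μ K, Φ u = (bR i : κ' → Matrix ι μ K) :=
    fun i => LinearMap.mem_range.1 (bR i).2
  choose u hu using hu
  set F : Fin ρ ⊕ R₀ → Matrix ι ι K[X] × Matrix μ μ K[X] := fun x => match x with
    | Sum.inl i => ((u i).1.map Polynomial.C, (u i).2.map Polynomial.C)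
    | Sum.inr r => (βt r, γt r) with hF
  have hFind : LinearIndependent K[X] F := by
    rw [Fintype.linearIndependent_iff]
    intro g hg
    rw [Fintype.sum_sum_type] at hg
    simp only [hF] at hg
    -- first: the `inl` coefficients vanish (trailing coefficients against the basis `bR`)
    have hg1 : ∀ i, g (Sum.inl i) = 0 := by
      by_contra hne
      push Not at hne
      set Fi : Finset (Fin ρ) := Finset.univ.filter fun i => g (Sum.inl i) ≠ 0 with hFi
      have hFne : Fi.Nonempty := hne.elim fun i hi => ⟨i, by simp [hFi, hi]⟩
      set Dg : Finset ℕ := Fi.image fun i => (g (Sum.inl i)).natTrailingDegree with hDg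
      have hDne : Dg.Nonempty := hFne.image _
      set d : ℕ := Dg.min' hDne with hdd
      obtain ⟨i₀, hi₀F, hi₀d⟩ : ∃ i₀ ∈ Fi, (g (Sum.inl i₀)).natTrailingDegree = d := by
        have hmem : d ∈ Dg := Finset.min'_mem Dg hDne
        simpa [hDg] using hmem
      have hi₀ : g (Sum.inl i₀) ≠ 0 := by simpa [hFi] using hi₀F
      have hcoeff₀ : (g (Sum.inl i₀)).coeff d ≠ 0 := by
        rw [← hi₀d]
        exact trailingCoeff_nonzero_iff_nonzero.2 hi₀
      have hlow : ∀ i e, e < d → (g (Sum.inl i)).coeff e = 0 := by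
        intro i e he
        by_cases hgi : g (Sum.inl i) = 0
        · simp [hgi]
        · have hle : d ≤ (g (Sum.inl i)).natTrailingDegree := Finset.min'_le _ _
            (Finset.mem_image.2 ⟨i, by simp [hFi, hgi], rfl⟩)
          exact coeff_eq_zero_of_lt_natTrailingDegree (lt_of_lt_of_le he hle)
      have hrel : ∀ b', ∑ i, g (Sum.inl i) • ((u i).1.map Polynomial.C * S b' -
          S b' * (u i).2.map Polynomial.C) = 0 := by
        intro b'
        have e1 := congr_arg Prod.fst hg
        have e2 := congr_arg Prod.snd hg
        simp only [Prod.fst_add, Prod.snd_add, Prod.fst_sum, Prod.snd_sum, Prod.smul_fst,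
          Prod.smul_snd, Prod.fst_zero, Prod.snd_zero] at e1 e2
        have e3 : (∑ i, g (Sum.inl i) • (u i).1.map Polynomial.C + ∑ r, g (Sum.inr r) • βt r) *
            S b' - S b' * (∑ i, g (Sum.inl i) • (u i).2.map Polynomial.C +
              ∑ r, g (Sum.inr r) • γt r) = 0 := by
          rw [e1, e2, Matrix.zero_mul, Matrix.mul_zero, sub_zero]
        rw [← e3]
        simp only [Matrix.add_mul, Matrix.mul_add, Matrix.sum_mul, Matrix.mul_sum,
          Matrix.smul_mul, Matrix.mul_smul, hcommX, smul_sub, Finset.sum_sub_distrib]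
        abel
      have hkey : ∑ i, ((g (Sum.inl i)).coeff d) • (bR i : κ' → Matrix ι μ K) = 0 := by
        funext b'
        ext a c
        have h0 := congr_arg (fun Mx : Matrix ι μ K[X] => (Mx a c).coeff (d + h)) (hrel b')
        simp only [Matrix.sum_apply, Matrix.smul_apply, Matrix.sub_apply, Matrix.mul_apply,
          Matrix.map_apply, smul_eq_mul, Matrix.zero_apply, coeff_zero, finsetSum_coeff] at h0
        simp only [Finset.sum_apply, Pi.smul_apply, Matrix.sum_apply, Matrix.smul_apply,
          smul_eq_mul, Pi.zero_apply, Matrix.zero_apply]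
        rw [← h0]
        refine Finset.sum_congr rfl fun i _ => ?_
        rw [← hu i]
        have hx : ∀ x, (g (Sum.inl i) * (Polynomial.C ((u i).1 a x) * S b' x c)).coeff (d + h) =
            (g (Sum.inl i)).coeff d * ((u i).1 a x * t x b' c) := by
          intro x
          rw [mul_left_comm, coeff_C_mul,
            coeff_mul_of_order _ _ d h (t x b' c) (hScoeff b' x c) (hlow i)]
          ring
        have hy : ∀ y, (g (Sum.inl i) * (S b' a y * Polynomial.C ((u i).2 y c))).coeff (d + h) =
            (g (Sum.inl i)).coeff d * (t a b' y * (u i).2 y c) := by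
          intro y
          rw [← mul_assoc, coeff_mul_C,
            coeff_mul_of_order _ _ d h (t a b' y) (hScoeff b' a y) (hlow i)]
          ring
        simp only [hΦ, LinearMap.coe_mk, AddHom.coe_mk, Matrix.sub_apply, Matrix.mul_apply,
          slice_apply, mul_sub, Finset.mul_sum, coeff_sub, finsetSum_coeff, hx, hy]
      have hbRind : LinearIndependent K (fun i => (bR i : κ' → Matrix ι μ K)) :=
        bR.linearIndependent.map' (LinearMap.range Φ).subtype (Submodule.ker_subtype _)
      exact hcoeff₀ (Fintype.linearIndependent_iff.1 hbRind _ hkey i₀)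
    have hg2 : ∀ r, g (Sum.inr r) = 0 := by
      have e1 := congr_arg Prod.fst hg
      simp only [Prod.fst_sum, Prod.smul_fst, Prod.fst_zero, hg1, zero_smul,
        Finset.sum_const_zero, zero_add] at e1
      exact hind (fun r => g (Sum.inr r)) e1
    rintro (i | r)
    exacts [hg1 i, hg2 r]
  -- rank count: `ρ + #R₀ ≤ rank_{K[ε]} PX = dim_K P = ρ + dim ker Φ ≤ ρ + dim D`
  have hcardle : Fintype.card (Fin ρ ⊕ R₀) ≤
      Module.finrank K[X] (Matrix ι ι K[X] × Matrix μ μ K[X]) :=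
    hFind.fintype_card_le_finrank
  have hPX : Module.finrank K[X] (Matrix ι ι K[X] × Matrix μ μ K[X]) =
      Fintype.card ((ι × ι) ⊕ (μ × μ)) :=
    Module.finrank_eq_card_basis ((Matrix.stdBasis K[X] ι ι).prod (Matrix.stdBasis K[X] μ μ))
  have hP : Module.finrank K (Matrix ι ι K × Matrix μ μ K) = Fintype.card ((ι × ι) ⊕ (μ × μ)) :=
    Module.finrank_eq_card_basis ((Matrix.stdBasis K ι ι).prod (Matrix.stdBasis K μ μ))
  have hrn : ρ + Module.finrank K (LinearMap.ker Φ) =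
      Module.finrank K (Matrix ι ι K × Matrix μ μ K) :=
    LinearMap.finrank_range_add_finrank_ker Φ
  have hkerD : Module.finrank K (LinearMap.ker Φ) ≤ Module.finrank K D :=
    Submodule.finrank_mono hker
  rw [Fintype.card_sum, Fintype.card_fin, hPX, ← hP, ← hrn] at hcardle
  omega

end Summit.MatrixMultiplication.MatrixMultiplication.Theorems.FarEdgeDescentCommutantObstruction
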